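import Summits.Ventures.CertifiedManyBodySolver.Theorems.ThermalStiffnessCeilingU8b8_le_7o44.Negative.LocalChargePinching
import HarnessLib

/-!
# Local charge bookkeeping of Jordan–Wigner words: the pinching of ANY local observable is even
(negative-side helper for the cruxes K1′ / K1 of route `TcThermcert1`)

Disprover's helper (`--supports stmt-Ventures-24560`; crux K1′ `TcThermcert1.ThermalStiffnessCeilingU8b8_le_7o44`, line of record
`Cruxes/ThermalStiffnessCeilingU8b8_le_7o44/Lines/gauge_qbp_far_seam.lean` v1.6, bet C8 `stub_currentClustering8`): generic half of finding
F10 — the PARITY hypothesis of Hypothesis C (`carEvenSubalgebra` rather than `carSubalgebra`) is redundant as well; the torus corollary is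
`CurrentClusteringLocalAlgebra.lean`. Sequel of `LocalChargePinching.lean` (F9).

BOOKKEEPING. A Jordan–Wigner word `w` with letters on the orbitals of a window `X` shifts the local charges
`ℓ_X(s) = ((upPart s ∩ X).card, (downPart s ∩ X).card)` of every configuration by a FIXED vector `δ(w) ∈ ℤ²` (`+1` per creation,
`−1` per annihilation letter, in the spin component of the letter): `wordOp w s t ≠ 0 ⇒ ℓ_X(s) = ℓ_X(t) + δ(w)`
(`locGrade_shift_of_wordOp_apply_ne_zero`), and `δ(w).1 + δ(w).2 ≡ |w| (mod 2)` (`even_shift_add_length`). Hence the local charge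
pinching `Σ_q Π_q · Π_q` of F9 FIXES a word with `δ(w) = 0` — which has EVEN length, so lies in the even CAR subalgebra
(`wordOp_mem_carEvenSubalgebra_of_even`) — and KILLS every other word (`gradedCompress_locGrade_wordOp`). By the word-span description of
`𝔄(orbSet X)` (tree `mem_span_wordOp_of_mem_carSubalgebra`): the pinching of EVERY `A ∈ 𝔄(orbSet X)` — even or not — lies in
`𝔄_even(orbSet X)` (`locPinch_mem_of_mem_carSubalgebra`). Also: an observable of the EMPTY window is a scalar
(`exists_mul_eq_smul_of_mem_carSubalgebra_orbSet_empty`).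

HONEST FRAMING: finite-dimensional folklore (local `U(1)×U(1)` gauge averaging maps the local CAR algebra onto its gauge-invariant = even,
charge-conserving part); NO KILL of K1′, of stub B or of the bet C8 is claimed, nothing here bears on clustering at
`(U, n, β) = (8, 7/8, 8)`, and superconductivity in the Hubbard model is neither proved nor disproved by anything in this file.
-/

noncomputable section

open scoped ComplexOrder ComplexConjugate Matrix.Norms.L2Operator
open Filter Topology Matrix Finset
open Literature.MathematicalPhysics.QuantumLattice
open Literature.Probability.LatticeModels
open Summit.Ventures.CertifiedManyBodySolver.Theorems.TcThermcert1.LocalChargePinching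
open Literature.LinearAlgebra.Matrix (gradedCompress gradedCompress_apply gradedCompress_add gradedCompress_smul
  gradedCompress_of_graded)

namespace Summit.Ventures.CertifiedManyBodySolver.Theorems.TcThermcert1.LocalChargeBookkeeping

/-! Throughout: the local charge grading of a window `X` is `s ↦ ((upPart s ∩ X).card, (downPart s ∩ X).card)`; the UP shift of a letter
`l = (orb x τ, b)` is `if τ = 0 then (if b then 1 else -1) else 0` and its DOWN shift `if τ = 0 then 0 else (if b then 1 else -1)`; the
shifts of a word are the sums over its letters. All four are written out in full in every statement. -/

section Generic

variable {Λ : Type*} [LinearOrder Λ] [Fintype Λ]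

/-! ## §1 One letter -/

/-- Nonzero entries of a Jordan–Wigner letter: a creation letter has `s = insert i t`, an annihilation letter `t = insert i s`.
[folklore] -/
theorem letterOp_apply_ne_zero {ι : Type*} [LinearOrder ι] [Fintype ι] {l : JWLetter ι} {s t : Finset ι}
    (h : letterOp l s t ≠ 0) : (l.2 = true ∧ l.1 ∉ t ∧ s = insert l.1 t) ∨ (l.2 = false ∧ l.1 ∉ s ∧ t = insert l.1 s) := by
  obtain ⟨i, b⟩ := l
  cases b with
  | false =>
    right
    have h' : annihilation i s t ≠ 0 := by simpa [letterOp] using h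
    rw [annihilation_apply] at h'
    by_cases hc : i ∉ s ∧ t = insert i s
    · exact ⟨rfl, hc.1, hc.2⟩
    · exact absurd (if_neg hc) h'
  | true =>
    left
    have h' : creation i s t ≠ 0 := by simpa [letterOp] using h
    rw [creation_apply] at h'
    by_cases hc : i ∉ t ∧ s = insert i t
    · exact ⟨rfl, hc.1, hc.2⟩
    · exact absurd (if_neg hc) h'

/-- Inserting the orbital `(x, τ)`, `x ∈ X`, raises exactly one of the two local charges of `X` by one. [folklore] -/
theorem card_parts_inter_insert_orb {X : Finset Λ} {x : Λ} (hx : x ∈ X) (τ : Fin 2) {u : Finset (Orb Λ)}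
    (hu : orb x τ ∉ u) :
    ((upPart (insert (orb x τ) u) ∩ X).card : ℤ) = (upPart u ∩ X).card + (if τ = 0 then 1 else 0) ∧
      ((downPart (insert (orb x τ) u) ∩ X).card : ℤ) = (downPart u ∩ X).card + (if τ = 0 then 0 else 1) := by
  have h2 : ∀ σ : Fin 2, σ = 0 ∨ σ = 1 := by decide
  rcases h2 τ with rfl | rfl
  · have hup : upPart (insert (orb x 0) u) = insert x (upPart u) := by
      ext y
      simp [Finset.mem_insert]
    have hdown : downPart (insert (orb x 0) u) = downPart u := by
      ext y
      simp [Finset.mem_insert]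
    have hxu : x ∉ upPart u ∩ X := fun h => hu ((mem_upPart _ _).1 (Finset.mem_inter.1 h).1)
    rw [hup, hdown, Finset.insert_inter_of_mem hx, Finset.card_insert_of_notMem hxu]
    simp
  · have hup : upPart (insert (orb x 1) u) = upPart u := by
      ext y
      simp [Finset.mem_insert]
    have hdown : downPart (insert (orb x 1) u) = insert x (downPart u) := by
      ext y
      simp [Finset.mem_insert]
    have hxu : x ∉ downPart u ∩ X := fun h => hu ((mem_downPart _ _).1 (Finset.mem_inter.1 h).1)
    rw [hup, hdown, Finset.insert_inter_of_mem hx, Finset.card_insert_of_notMem hxu]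
    simp

/-- The same for a general orbital `i` of a site of `X` (`i = orb (ofLex i).1 (ofLex i).2` definitionally). [folklore] -/
theorem card_parts_inter_insert {X : Finset Λ} {i : Orb Λ} (hx : (ofLex i).1 ∈ X) {u : Finset (Orb Λ)} (hu : i ∉ u) :
    ((upPart (insert i u) ∩ X).card : ℤ) = (upPart u ∩ X).card + (if (ofLex i).2 = 0 then 1 else 0) ∧
      ((downPart (insert i u) ∩ X).card : ℤ) = (downPart u ∩ X).card + (if (ofLex i).2 = 0 then 0 else 1) := by
  have hu' : orb (ofLex i).1 (ofLex i).2 ∉ u := hu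
  exact card_parts_inter_insert_orb hx (ofLex i).2 hu'

/-- One letter on an orbital of `X` shifts the local charges of `X` by its (up, down) shift. [folklore] -/
theorem locGrade_shift_of_letterOp_apply_ne_zero {X : Finset Λ} {l : JWLetter (Orb Λ)} (hl : l.1 ∈ orbSet X)
    {s t : Finset (Orb Λ)} (h : letterOp l s t ≠ 0) :
    ((upPart s ∩ X).card : ℤ) = (upPart t ∩ X).card +
        (if (ofLex l.1).2 = 0 then (if l.2 = true then (1 : ℤ) else -1) else 0) ∧
      ((downPart s ∩ X).card : ℤ) = (downPart t ∩ X).card +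
        (if (ofLex l.1).2 = 0 then (0 : ℤ) else (if l.2 = true then 1 else -1)) := by
  have hx : (ofLex l.1).1 ∈ X := mem_orbSet.1 hl
  rcases letterOp_apply_ne_zero h with ⟨hb, hni, hs⟩ | ⟨hb, hni, ht⟩
  · obtain ⟨h1, h2⟩ := card_parts_inter_insert hx hni
    have eU : (if (ofLex l.1).2 = 0 then (if l.2 = true then (1 : ℤ) else -1) else 0) =
        (if (ofLex l.1).2 = 0 then (1 : ℤ) else 0) := by
      rw [hb]; by_cases hc : (ofLex l.1).2 = 0 <;> simp [hc]
    have eD : (if (ofLex l.1).2 = 0 then (0 : ℤ) else (if l.2 = true then 1 else -1)) =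
        (if (ofLex l.1).2 = 0 then (0 : ℤ) else 1) := by
      rw [hb]; by_cases hc : (ofLex l.1).2 = 0 <;> simp [hc]
    rw [eU, eD, hs]
    exact ⟨h1, h2⟩
  · obtain ⟨h1, h2⟩ := card_parts_inter_insert hx hni
    have eU : (if (ofLex l.1).2 = 0 then (if l.2 = true then (1 : ℤ) else -1) else 0) =
        -(if (ofLex l.1).2 = 0 then (1 : ℤ) else 0) := by
      rw [hb]; by_cases hc : (ofLex l.1).2 = 0 <;> simp [hc]
    have eD : (if (ofLex l.1).2 = 0 then (0 : ℤ) else (if l.2 = true then 1 else -1)) =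
        -(if (ofLex l.1).2 = 0 then (0 : ℤ) else 1) := by
      rw [hb]; by_cases hc : (ofLex l.1).2 = 0 <;> simp [hc]
    rw [eU, eD, ht]
    constructor <;> linarith

/-! ## §2 Words: the shift vector and its parity -/

/-- **A word shifts the local charges by a fixed vector**: `wordOp w s t ≠ 0 ⇒ ℓ_X(s) = ℓ_X(t) + δ(w)`. [folklore] -/
theorem locGrade_shift_of_wordOp_apply_ne_zero (X : Finset Λ) :
    ∀ (w : List (JWLetter (Orb Λ))), LettersIn (orbSet X) w → ∀ (s t : Finset (Orb Λ)), wordOp w s t ≠ 0 →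
      ((upPart s ∩ X).card : ℤ) = (upPart t ∩ X).card +
          (w.map fun l => if (ofLex l.1).2 = 0 then (if l.2 = true then (1 : ℤ) else -1) else 0).sum ∧
        ((downPart s ∩ X).card : ℤ) = (downPart t ∩ X).card +
          (w.map fun l => if (ofLex l.1).2 = 0 then (0 : ℤ) else (if l.2 = true then 1 else -1)).sum
  | [], _, s, t, h => by
    rw [wordOp_nil] at h
    have hst : s = t := by
      by_contra hne
      exact h (Matrix.one_apply_ne hne)
    subst hst
    simp
  | l :: w, hw, s, t, h => by
    rw [lettersIn_cons] at hw
    rw [wordOp_cons, Matrix.mul_apply] at h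
    obtain ⟨u, -, hu⟩ := Finset.exists_ne_zero_of_sum_ne_zero h
    obtain ⟨h1u, h1d⟩ := locGrade_shift_of_letterOp_apply_ne_zero hw.1 (left_ne_zero_of_mul hu)
    obtain ⟨h2u, h2d⟩ := locGrade_shift_of_wordOp_apply_ne_zero X w hw.2 u t (right_ne_zero_of_mul hu)
    simp only [List.map_cons, List.sum_cons]
    constructor <;> linarith

omit [LinearOrder Λ] [Fintype Λ] in
/-- The two shifts of a word and its length have even sum (each letter contributes `±1 + 1`). [folklore] -/
theorem even_shift_add_length [LinearOrder Λ] :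
    ∀ (w : List (JWLetter (Orb Λ))),
      Even ((w.map fun l => if (ofLex l.1).2 = 0 then (if l.2 = true then (1 : ℤ) else -1) else 0).sum +
        (w.map fun l => if (ofLex l.1).2 = 0 then (0 : ℤ) else (if l.2 = true then 1 else -1)).sum + (w.length : ℤ))
  | [] => by simp
  | l :: w => by
    have ih := even_shift_add_length w
    simp only [List.map_cons, List.sum_cons, List.length_cons, Nat.cast_succ]
    set a : ℤ := (if (ofLex l.1).2 = 0 then (if l.2 = true then (1 : ℤ) else -1) else 0) with ha
    set b : ℤ := (if (ofLex l.1).2 = 0 then (0 : ℤ) else (if l.2 = true then 1 else -1)) with hb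
    set U : ℤ := (w.map fun l => if (ofLex l.1).2 = 0 then (if l.2 = true then (1 : ℤ) else -1) else 0).sum with hU
    set D : ℤ := (w.map fun l => if (ofLex l.1).2 = 0 then (0 : ℤ) else (if l.2 = true then 1 else -1)).sum with hD
    have hl : Even (a + b + 1) := by
      rw [ha, hb]
      split_ifs <;> decide
    have e : a + U + (b + D) + ((w.length : ℤ) + 1) = (a + b + 1) + (U + D + (w.length : ℤ)) := by ring
    rw [e]
    exact hl.add ih

/-- **The local charge pinching of a local word is the word (then of even length) or zero.** [folklore] -/
theorem gradedCompress_locGrade_wordOp (X : Finset Λ) {w : List (JWLetter (Orb Λ))} (hw : LettersIn (orbSet X) w) :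
    (gradedCompress (fun s : Finset (Orb Λ) => ((upPart s ∩ X).card, (downPart s ∩ X).card)) (wordOp w) = wordOp w ∧
        Even w.length) ∨
      gradedCompress (fun s : Finset (Orb Λ) => ((upPart s ∩ X).card, (downPart s ∩ X).card)) (wordOp w) = 0 := by
  by_cases hδ : (w.map fun l => if (ofLex l.1).2 = 0 then (if l.2 = true then (1 : ℤ) else -1) else 0).sum = 0 ∧
      (w.map fun l => if (ofLex l.1).2 = 0 then (0 : ℤ) else (if l.2 = true then 1 else -1)).sum = 0
  · left
    refine ⟨gradedCompress_of_graded fun s t hst => ?_, ?_⟩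
    · by_contra h0
      obtain ⟨hu, hd⟩ := locGrade_shift_of_wordOp_apply_ne_zero X w hw s t h0
      rw [hδ.1, add_zero] at hu
      rw [hδ.2, add_zero] at hd
      exact hst (Prod.ext (by exact_mod_cast hu) (by exact_mod_cast hd))
    · have he := even_shift_add_length w
      rw [hδ.1, hδ.2, zero_add, zero_add] at he
      exact (Int.even_coe_nat _).1 he
  · right
    ext s t
    rw [gradedCompress_apply, Matrix.zero_apply]
    split_ifs with hg
    · by_contra h0
      obtain ⟨hu, hd⟩ := locGrade_shift_of_wordOp_apply_ne_zero X w hw s t h0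
      obtain ⟨h1, h2⟩ := Prod.mk.inj hg
      refine hδ ⟨?_, ?_⟩
      · rw [h1] at hu; linarith
      · rw [h2] at hd; linarith
    · rfl

/-- A word of EVEN length with letters in `S` lies in the even CAR subalgebra of `S` (pair the letters). [folklore] -/
theorem wordOp_mem_carEvenSubalgebra_of_even {ι : Type*} [LinearOrder ι] [Fintype ι] {S : Finset ι} :
    ∀ {w : List (JWLetter ι)}, LettersIn S w → Even w.length → wordOp w ∈ carEvenSubalgebra S
  | [], _, _ => by
    rw [wordOp_nil]
    exact Subalgebra.one_mem _
  | [l], _, h => by simp at h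
  | l :: l' :: w, hw, h => by
    rw [lettersIn_cons] at hw
    obtain ⟨hl, hw⟩ := hw
    rw [lettersIn_cons] at hw
    obtain ⟨hl', hw⟩ := hw
    have hlen : Even w.length := by
      simp only [List.length_cons] at h
      simpa [Nat.even_add_one] using h
    rw [wordOp_cons, wordOp_cons, ← Matrix.mul_assoc]
    refine Subalgebra.mul_mem _ ?_ (wordOp_mem_carEvenSubalgebra_of_even hw hlen)
    change letterOp l * letterOp l' ∈ Algebra.adjoin ℂ (carEvenGenerators S)
    exact Algebra.subset_adjoin ⟨l, l', hl, hl', rfl⟩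

/-! ## §3 The pinching of any local observable is even and local -/

/-- **The local charge pinching maps the FULL local algebra into the EVEN local algebra**: for every `A ∈ 𝔄(orbSet X)` — of either
parity — `Σ_q Π_q A Π_q ∈ 𝔄_even(orbSet X)`. [folklore] -/
theorem locPinch_mem_of_mem_carSubalgebra {X : Finset Λ} {A : Matrix (Finset (Orb Λ)) (Finset (Orb Λ)) ℂ}
    (hA : A ∈ carSubalgebra (orbSet X)) :
    gradedCompress (fun s : Finset (Orb Λ) => ((upPart s ∩ X).card, (downPart s ∩ X).card)) A ∈
      carEvenSubalgebra (orbSet X) := by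
  have h := mem_span_wordOp_of_mem_carSubalgebra hA
  refine Submodule.span_induction (p := fun a _ =>
    gradedCompress (fun s : Finset (Orb Λ) => ((upPart s ∩ X).card, (downPart s ∩ X).card)) a ∈
      carEvenSubalgebra (orbSet X)) ?_ ?_ ?_ ?_ h
  · rintro M ⟨w, hw, rfl⟩
    rcases gradedCompress_locGrade_wordOp X hw with ⟨hEq, hev⟩ | h0
    · rw [hEq]
      exact wordOp_mem_carEvenSubalgebra_of_even hw hev
    · rw [h0]
      exact Subalgebra.zero_mem _
  · have h0 : gradedCompress (fun s : Finset (Orb Λ) => ((upPart s ∩ X).card, (downPart s ∩ X).card))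
        (0 : Matrix (Finset (Orb Λ)) (Finset (Orb Λ)) ℂ) = 0 := by
      ext s t
      simp [gradedCompress_apply]
    rw [h0]
    exact Subalgebra.zero_mem _
  · intro a b _ _ ha hb
    rw [gradedCompress_add]
    exact Subalgebra.add_mem _ ha hb
  · intro c a _ ha
    rw [gradedCompress_smul]
    exact Subalgebra.smul_mem _ ha c

/-- **An observable of the EMPTY window — of either parity — acts as a scalar** (`𝔄(orbSet ∅) = ⊥`). [folklore] -/
theorem exists_mul_eq_smul_of_mem_carSubalgebra_orbSet_empty {A : Matrix (Finset (Orb Λ)) (Finset (Orb Λ)) ℂ}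
    (hA : A ∈ carSubalgebra (orbSet (∅ : Finset Λ))) :
    ∃ c : ℂ, ∀ B : Matrix (Finset (Orb Λ)) (Finset (Orb Λ)) ℂ, A * B = c • B := by
  have hgen : carGenerators (orbSet (∅ : Finset Λ)) = ∅ := by
    ext M
    simp only [carGenerators, Set.mem_setOf_eq, Set.mem_empty_iff_false, iff_false]
    rintro ⟨l, hl, -⟩
    rw [mem_orbSet] at hl
    exact Finset.notMem_empty _ hl
  have hbot : carSubalgebra (orbSet (∅ : Finset Λ)) = ⊥ := by
    rw [carSubalgebra, hgen, Algebra.adjoin_empty]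
  rw [hbot, Algebra.mem_bot] at hA
  obtain ⟨c, rfl⟩ := Set.mem_range.1 hA
  exact ⟨c, fun B => by rw [Algebra.algebraMap_eq_smul_one, smul_one_mul]⟩

end Generic

end Summit.Ventures.CertifiedManyBodySolver.Theorems.TcThermcert1.LocalChargeBookkeeping

end
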